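import Literature.NumberTheory.Automorphic.UnitaryGroupHermitianPairingBound
import Literature.NumberTheory.Automorphic.UnitaryGroupOfFormAdelicTopology
import Literature.NumberTheory.Automorphic.MahlerCriterionGLn
import Literature.NumberTheory.Automorphic.GodementCompactness
import Literature.NumberTheory.Automorphic.AdelicHeightZetaUniform
import HarnessLib

/-!
# Every adelic point of `U(J_N)` (`N ≥ 2`) carries a rational ISOTROPIC vector of bounded height —
# the covering half of reduction theory for the quasi-split unitary groups

Topic `NumberTheory/Automorphic`; namespace `Literature.NumberTheory.Automorphic.UnitaryGroup`.
Proof file: theorems only (no definition, no named fact, no instance, no `sorry`); imports = tree.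
Setting as in `UnitaryGroupHermitianPairingBound`: `g ∈ U(J_N)(𝔸_F)` (`quasiSplit F E c N`), the
matrix `M = adelicVal g ∈ GL_N(𝔸_E)`, rational row vectors `ξ ∈ E^N`, the height
`h(ξ g) = vecHeight E (principalVec E ξ ᵥ* M)` and the hermitian form `⟨ξ, η⟩ = Σ_i ξ_i c(η_{N+1-i})`.

MAIN THEOREM `exists_forall_exists_isotropic_vecHeight_le` (§4): for `N ≥ 2` **there is a constant
`B` such that every `g ∈ U(J_N)(𝔸_F)` admits a rational vector `ξ ≠ 0` with `⟨ξ, ξ⟩ = 0` and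
`h(ξ g) ≤ B`.** This is the covering statement of reduction theory for `U(J_N)` (Borel (1963), §5;
Godement, Sém. Bourbaki 257 (1962/63), §1–§3; for `U(3)`: Rogawski (1990), §2.1–2.2, the Siegel
domain `{H(g) > c₀}` covers `G(F)\G(𝔸_F)` once an isotropic line of height `≤ B` is moved to `e_N` by
Witt's theorem) — proved here by TURNING AROUND the tree's proof of Godement's compactness
criterion for ANISOTROPIC unitary groups (★ `GodementCompactness`):
* take an almost-shortest rational vector `ξ₀` (★ `exists_vecHeight_vecMul_le_two_mul`);
  **Case A** `h(ξ₀ g) < 1`: then `ξ₀` is isotropic by Godement's pairing inequality (★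
  `isotropic_of_vecHeight_vecMul_lt_one`: `1 ≤ h(ξ g)²` if `⟨ξ, ξ⟩ ≠ 0`) — done with `B ≥ 1`;
* **Case B** `h(ξ₀ g) ≥ 1`: then every rational vector has `h(ξ g) ≥ ½` and `|det g|_𝔸 = 1` (§2), so
  MAHLER'S CRITERION (★ `Mahler.exists_isCompact_rational_mul`) gives `g = γ₀ · m₀` with
  `γ₀ ∈ GL_N(E)` and `m₀` in a FIXED compact `C`; the Gram matrix `G(m₀) = m₀ J ᵗ(c m₀)` of the hermitian
  form on the rows of `m₀` equals `G(γ₀⁻¹ g) = G(γ₀⁻¹)` (the form is `U(J_N)(𝔸_F)`-invariant, §1),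
  a RATIONAL matrix lying in the compact `G(C)`: there are only FINITELY MANY such (★
  `Godement.finite_inter_principalMatrices`). For each of these finitely many Gram classes `Γ` choose
  once and for all a witness `(γ_Γ, g_Γ, m_Γ)`; then `ξ := (e₀ γ_Γ) γ₀⁻¹` is isotropic for the current
  `g` (sesquilinearity §1: `⟨a m₀, a m₀⟩` depends on `m₀` only through `G(m₀) = Γ = G(m_Γ)`, and
  `⟨(e₀ γ_Γ) m_Γ, (e₀ γ_Γ) m_Γ⟩ = ⟨e₀ g_Γ, e₀ g_Γ⟩ = ⟨e₀, e₀⟩ = 0` as `N ≥ 2`), and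
  `h(ξ g) = h((e₀ γ_Γ) m₀) ≤ H(m₀) · h(e₀ γ_Γ)` (★ `vecHeight_vecMul_le`, ★
  `exists_matHeightBound_le_of_isCompact`) is bounded by the finitely many choices.
No case distinction on places, no Minkowski successive minima and no Cassels-type height bound for
isotropic vectors are needed. Every `N ≥ 2`, every quadratic `E/F` with involution `c`.

* §1 algebra of the Gram matrix `G(A) = A J ᵗ(cA)`: `antidiagOver_mulVec`, `pairing_vecMul_eq`
  (sesquilinearity `⟨uA, vA⟩ = u · G(A) · c(v)`), `gram_apply`, `gram_mul_adelicVal` (invariance),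
  `gram_map_algebraMap_mem_principalMatrices` (rational `A` ⇒ rational `G(A)`).
* §2 `ideleNorm_det_adelicVal` — `|det g|_𝔸 = 1` on `U(J_N)(𝔸_F)`.
* §3 `exists_isCompact_forall_exists_eq_mul` — Mahler for `U(J_N)`: a compact `C ⊆ GL_N(𝔸_E)` with
  `g ∈ GL_N(E) · C` whenever all rational vectors have `h(ξ g) ≥ ½`.
* §4 the main theorem.

## References

* A. Borel, *Some finiteness properties of adele groups over number fields*, Publ. Math. IHÉS 16
  (1963), §5 [Borel1963].
* R. Godement, *Domaines fondamentaux des groupes arithmétiques*, Sém. Bourbaki 257 (1962/63),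
  §1.1–§1.2, §3 [Godement1964].
* J. D. Rogawski, *Automorphic Representations of Unitary Groups in Three Variables* (1990), §2.1
  [Rogawski1990].
-/

set_option autoImplicit false

noncomputable section

open NumberField IsDedekindDomain Matrix
open scoped NNReal MatrixGroups Pointwise

namespace Literature.NumberTheory.Automorphic

namespace UnitaryGroup

variable {F E : Type} [Field F] [NumberField F] [Field E] [NumberField E] [Algebra F E]
  {c : E ≃ₐ[F] E} {N : ℕ}

/-! ## §1 The Gram matrix `G(A) = A · J_N · ᵗ(c A)` of the hermitian form on the rows of `A` -/

omit [NumberField F] in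
/-- `J_N w = w ∘ rev`: the antidiagonal matrix reverses the coordinates. [cite: Rogawski1990, §1.9 p. 13] -/
theorem antidiagOver_mulVec {R : Type*} [CommRing R] (w : Fin N → R) :
    ((StdForm.antidiagonal N).over R) *ᵥ w = fun k => w (Fin.rev k) := by
  funext k
  rw [Matrix.mulVec, dotProduct, Finset.sum_eq_single (Fin.rev k)]
  · have h : (StdForm.antidiagonal N).over R k (Fin.rev k) = 1 := by
      simp [StdForm.over, Matrix.map_apply, StdForm.antidiagonal_J_apply]
    rw [h, one_mul]
  · intro l _ hl
    have h : (StdForm.antidiagonal N).over R k l = 0 := by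
      simp [StdForm.over, Matrix.map_apply, StdForm.antidiagonal_J_apply, hl]
    rw [h, zero_mul]
  · intro h; exact absurd (Finset.mem_univ _) h

omit [NumberField F] in
/-- **Sesquilinearity**: `⟨u A, v A⟩ = u · (A J ᵗ(cA)) · c(v)` for all adelic `u, v` and every matrix
`A`, with `⟨x, y⟩ = Σ_k x_k c(y_{rev k})`. [cite: Godement1964, §1.1] -/
theorem pairing_vecMul_eq (A : Matrix (Fin N) (Fin N) (AdeleRing (𝓞 E) E))
    (u v : Fin N → AdeleRing (𝓞 E) E) :
    (u ᵥ* A) ⬝ᵥ (fun k => c • (v ᵥ* A) (Fin.rev k)) =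
      u ⬝ᵥ ((A * (StdForm.antidiagonal N).over (AdeleRing (𝓞 E) E) * (A.map (conjAdele F E c))ᵀ) *ᵥ
        fun k => c • v k) := by
  have h1 : (fun k => c • (v ᵥ* A) (Fin.rev k)) =
      ((StdForm.antidiagonal N).over (AdeleRing (𝓞 E) E)) *ᵥ
        ((A.map (conjAdele F E c))ᵀ *ᵥ fun k => c • v k) := by
    rw [Matrix.mulVec_transpose, antidiagOver_mulVec]
    funext k
    change conjAdele F E c ((v ᵥ* A) (Fin.rev k)) = _
    rw [RingHom.map_vecMul]
    rfl
  rw [h1, Matrix.mulVec_mulVec, Matrix.dotProduct_mulVec, Matrix.dotProduct_mulVec, Matrix.vecMul_vecMul,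
    Matrix.mul_assoc]

omit [NumberField F] in
/-- The entries of the Gram matrix are the pairings of the rows: `G(A)_{ij} = ⟨e_i A, e_j A⟩`.
[cite: Godement1964, §1.1] -/
theorem gram_apply (A : Matrix (Fin N) (Fin N) (AdeleRing (𝓞 E) E)) (i j : Fin N) :
    (A * (StdForm.antidiagonal N).over (AdeleRing (𝓞 E) E) * (A.map (conjAdele F E c))ᵀ) i j =
      (Pi.single i 1 ᵥ* A) ⬝ᵥ (fun k => c • (Pi.single j 1 ᵥ* A) (Fin.rev k)) := by
  classical
  rw [pairing_vecMul_eq]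
  have hj : (fun k => c • (Pi.single j (1 : AdeleRing (𝓞 E) E) : Fin N → AdeleRing (𝓞 E) E) k) =
      Pi.single j 1 := by
    funext k
    by_cases hk : k = j
    · subst hk; rw [Pi.single_eq_same, smul_one]
    · rw [Pi.single_eq_of_ne hk, smul_zero]
  rw [hj, Matrix.mulVec_single_one]
  simp [Matrix.col_apply]

/-- **`U(J_N)(𝔸_F)`-invariance of the Gram matrix**: `G(A · g) = G(A)` for `g ∈ U(J_N)(𝔸_F)` (★
`dotProduct_antidiag_conj_vecMul_eq` row by row). [cite: Godement1964, §1.1] -/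
theorem gram_mul_adelicVal (A : Matrix (Fin N) (Fin N) (AdeleRing (𝓞 E) E)) (g : (quasiSplit F E c N).Adelic) :
    (A * (adelicVal F E c N _ g : Matrix (Fin N) (Fin N) (AdeleRing (𝓞 E) E))) *
        (StdForm.antidiagonal N).over (AdeleRing (𝓞 E) E) *
        ((A * (adelicVal F E c N _ g : Matrix (Fin N) (Fin N) (AdeleRing (𝓞 E) E))).map (conjAdele F E c))ᵀ =
      A * (StdForm.antidiagonal N).over (AdeleRing (𝓞 E) E) * (A.map (conjAdele F E c))ᵀ := by
  ext i j
  rw [gram_apply, gram_apply, ← Matrix.vecMul_vecMul, ← Matrix.vecMul_vecMul,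
    dotProduct_antidiag_conj_vecMul_eq]

omit [NumberField F] in
/-- `e_i (γ)_𝔸 = (e_i γ)_𝔸`: rows of a principal matrix are principal vectors. [cite: Godement1964, §1.1] -/
theorem single_vecMul_map_algebraMap (γ : Matrix (Fin N) (Fin N) E) (i : Fin N) :
    Pi.single i 1 ᵥ* γ.map (algebraMap E (AdeleRing (𝓞 E) E)) = principalVec E (Pi.single i 1 ᵥ* γ) := by
  classical
  funext k
  have h := RingHom.map_vecMul (algebraMap E (AdeleRing (𝓞 E) E)) γ (Pi.single i 1) k
  have hs : ((algebraMap E (AdeleRing (𝓞 E) E)) ∘ Pi.single i (1 : E)) = Pi.single i 1 := by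
    funext l
    by_cases hl : l = i
    · subst hl; simp
    · simp [Pi.single_eq_of_ne hl]
  rw [hs] at h
  rw [← h]
  rfl

omit [NumberField F] in
/-- More generally `(a)_𝔸 (γ)_𝔸 = (a γ)_𝔸`. [cite: Godement1964, §1.1] -/
theorem principalVec_vecMul_map_algebraMap (γ : Matrix (Fin N) (Fin N) E) (a : Fin N → E) :
    principalVec E a ᵥ* γ.map (algebraMap E (AdeleRing (𝓞 E) E)) = principalVec E (a ᵥ* γ) := by
  funext k
  have h := RingHom.map_vecMul (algebraMap E (AdeleRing (𝓞 E) E)) γ a k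
  rw [principalVec_apply, h]
  rfl

omit [NumberField F] in
/-- **The Gram matrix of a principal matrix is principal**: `G((γ)_𝔸) ∈ M_N(E)`.
[cite: Godement1964, §1.1] -/
theorem gram_map_algebraMap_mem_principalMatrices (γ : Matrix (Fin N) (Fin N) E) :
    γ.map (algebraMap E (AdeleRing (𝓞 E) E)) * (StdForm.antidiagonal N).over (AdeleRing (𝓞 E) E) *
        ((γ.map (algebraMap E (AdeleRing (𝓞 E) E))).map (conjAdele F E c))ᵀ ∈
      Godement.principalMatrices E := by
  intro i j
  rw [gram_apply, single_vecMul_map_algebraMap, single_vecMul_map_algebraMap,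
    dotProduct_antidiag_conj_principalVec]
  exact ⟨_, rfl⟩

omit [NumberField F] in
/-- **The Gram matrix is continuous** on `GL_N(𝔸_E)`. [cite: Godement1964, §1.1] -/
theorem continuous_gram :
    Continuous fun m : GL (Fin N) (AdeleRing (𝓞 E) E) =>
      (m : Matrix (Fin N) (Fin N) (AdeleRing (𝓞 E) E)) * (StdForm.antidiagonal N).over (AdeleRing (𝓞 E) E) *
        ((m : Matrix (Fin N) (Fin N) (AdeleRing (𝓞 E) E)).map (conjAdele F E c))ᵀ := by
  have hval : Continuous fun m : GL (Fin N) (AdeleRing (𝓞 E) E) =>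
      (m : Matrix (Fin N) (Fin N) (AdeleRing (𝓞 E) E)) := Units.continuous_val
  exact (hval.matrix_mul continuous_const).matrix_mul
    ((hval.matrix_map (continuous_conjAdele F E c)).matrix_transpose)

/-! ## §2 `|det g|_𝔸 = 1` on `U(J_N)(𝔸_F)` -/

/-- **`|det g|_𝔸 = 1` for `g ∈ U(J_N)(𝔸_F)`**: `c(det g) · det g = 1` from `ᵗ(cg) J g = J`, and
`|c(a)|_𝔸 = |a|_𝔸` (★ `ideleNorm_galSmul`). [cite: Godement1964, §1.1] -/
theorem ideleNorm_det_adelicVal (g : (quasiSplit F E c N).Adelic) :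
    IdeleClassGroup.ideleNorm E (Matrix.GeneralLinearGroup.det (adelicVal F E c N _ g)) = 1 := by
  set M : GL (Fin N) (AdeleRing (𝓞 E) E) := adelicVal F E c N _ g with hM
  have hg := mem_unitaryGroupOfForm_iff.1 (adelicVal_mem_unitaryGroupOfForm g)
  set J : Matrix (Fin N) (Fin N) (AdeleRing (𝓞 E) E) := (StdForm.antidiagonal N).over (AdeleRing (𝓞 E) E)
    with hJ
  -- the determinant identity `c(det M) * det M = 1`
  have hdet : conjAdele F E c (M : Matrix (Fin N) (Fin N) (AdeleRing (𝓞 E) E)).det *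
      (M : Matrix (Fin N) (Fin N) (AdeleRing (𝓞 E) E)).det = 1 := by
    have h := congrArg Matrix.det hg
    rw [Matrix.det_mul, Matrix.det_mul, Matrix.det_transpose] at h
    have hmd : ((M : Matrix (Fin N) (Fin N) (AdeleRing (𝓞 E) E)).map (conjAdele F E c)).det =
        conjAdele F E c (M : Matrix (Fin N) (Fin N) (AdeleRing (𝓞 E) E)).det :=
      (RingHom.map_det (conjAdele F E c) _).symm
    rw [hmd] at h
    have hJJ : J.det * J.det = 1 := by
      rw [← Matrix.det_mul, hJ, StdForm.over_mul_over, Matrix.det_one]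
    have hJu : IsUnit J.det := isUnit_iff_exists_inv.2 ⟨J.det, hJJ⟩
    have h' : conjAdele F E c (M : Matrix (Fin N) (Fin N) (AdeleRing (𝓞 E) E)).det *
        (M : Matrix (Fin N) (Fin N) (AdeleRing (𝓞 E) E)).det * J.det = 1 * J.det := by
      rw [one_mul]
      calc _ = conjAdele F E c (M : Matrix (Fin N) (Fin N) (AdeleRing (𝓞 E) E)).det * J.det *
            (M : Matrix (Fin N) (Fin N) (AdeleRing (𝓞 E) E)).det := by ring
        _ = J.det := h
    exact hJu.mul_left_injective h'
  -- as ideles: `(c • det M) * det M = 1`, and `|c • det M| = |det M|`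
  set d : (AdeleRing (𝓞 E) E)ˣ := Matrix.GeneralLinearGroup.det M with hd
  set d' : (AdeleRing (𝓞 E) E)ˣ :=
    Units.map (MulSemiringAction.toRingHom (E ≃ₐ[F] E) (AdeleRing (𝓞 E) E) c : _ →* _) d with hd'
  have hdd : d' * d = 1 := by
    ext
    rw [Units.val_mul, hd', Units.coe_map, MonoidHom.coe_coe, MulSemiringAction.toRingHom_apply,
      Units.val_one, hd, Matrix.GeneralLinearGroup.val_det_apply, ← conjAdele_apply]
    exact hdet
  have hn : IdeleClassGroup.ideleNorm E d' * IdeleClassGroup.ideleNorm E d = 1 := by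
    rw [← map_mul, hdd, map_one]
  rw [hd', ideleNorm_galSmul] at hn
  have hsq : IdeleClassGroup.ideleNorm E d ^ 2 = 1 := by rw [sq]; exact hn
  exact (pow_eq_one_iff_of_nonneg (by positivity) two_ne_zero).1 hsq

/-! ## §3 Mahler's criterion for `U(J_N)` -/

/-- **Mahler's criterion on `U(J_N)(𝔸_F)`**: there is a compact `C ⊆ GL_N(𝔸_E)` such that every
`g ∈ U(J_N)(𝔸_F)` all of whose rational vectors have height `h(ξ g) ≥ ½` factors as `g = γ₀ · m₀` with
`γ₀ ∈ GL_N(E)` and `m₀ ∈ C` (★ `Mahler.exists_isCompact_rational_mul` with `|det g|_𝔸 = 1`).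
[cite: Godement1964, §3, Thm. 3] -/
theorem exists_isCompact_forall_exists_eq_mul :
    ∃ C : Set (GL (Fin N) (AdeleRing (𝓞 E) E)), IsCompact C ∧ ∀ g : (quasiSplit F E c N).Adelic,
      (∀ ξ : Fin N → E, ξ ≠ 0 →
        (2 : ℝ≥0)⁻¹ ≤ vecHeight E (principalVec E ξ ᵥ* (adelicVal F E c N _ g : Matrix (Fin N) (Fin N) (AdeleRing (𝓞 E) E)))) →
      ∃ γ₀ : GL (Fin N) E, ∃ m₀ ∈ C,
        adelicVal F E c N _ g = Matrix.GeneralLinearGroup.map (algebraMap E (AdeleRing (𝓞 E) E)) γ₀ * m₀ := by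
  obtain ⟨C, hC, h⟩ := Mahler.exists_isCompact_rational_mul N E 2⁻¹ 1 (by positivity)
  refine ⟨C, hC, fun g hg => ?_⟩
  have hm := h (adelicVal F E c N _ g) hg (le_of_eq (ideleNorm_det_adelicVal g))
  obtain ⟨x, ⟨γ₀, rfl⟩, m₀, hm₀, hx⟩ := Set.mem_mul.1 hm
  exact ⟨γ₀, m₀, hm₀, hx.symm⟩

/-! ## §4 The isotropic vector of bounded height -/

omit [NumberField F] [NumberField E] in
/-- `v P = 0 ⇒ v = 0` for an invertible matrix `P` over a field (plumbing). [cite: Godement1964, §1.1] -/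
theorem eq_zero_of_vecMul_eq_zero (P : GL (Fin N) E) {v : Fin N → E}
    (h : v ᵥ* (P : Matrix (Fin N) (Fin N) E) = 0) : v = 0 := by
  have h1 : v = (v ᵥ* (P : Matrix (Fin N) (Fin N) E)) ᵥ* ((P⁻¹ : GL (Fin N) E) : Matrix (Fin N) (Fin N) E) := by
    rw [Matrix.vecMul_vecMul, ← Units.val_mul, mul_inv_cancel, Units.val_one, Matrix.vecMul_one]
  rw [h1, h, Matrix.zero_vecMul]

omit [NumberField F] in
/-- `e₀` is isotropic for `J_N` when `N ≥ 2`: `⟨e₀, e₀⟩ = c((e₀)_{rev 0}) = 0`. [cite: Rogawski1990, §1.9 p. 13] -/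
theorem dotProduct_antidiag_conj_single_zero [NeZero N] (hN : 2 ≤ N) :
    ((Pi.single (0 : Fin N) (1 : AdeleRing (𝓞 E) E) : Fin N → AdeleRing (𝓞 E) E) ⬝ᵥ fun k =>
      c • (Pi.single (0 : Fin N) (1 : AdeleRing (𝓞 E) E) : Fin N → AdeleRing (𝓞 E) E) (Fin.rev k)) = 0 := by
  classical
  have hrev : Fin.rev (0 : Fin N) ≠ 0 := by
    intro h
    have h' := congrArg Fin.val h
    rw [Fin.val_rev, Fin.val_zero] at h'
    omega
  simp [hrev]

/-- **EVERY `g ∈ U(J_N)(𝔸_F)` HAS A RATIONAL ISOTROPIC VECTOR OF BOUNDED HEIGHT** (`N ≥ 2`): there is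
`B` such that for every `g` there is `ξ ∈ E^N ∖ 0` with `⟨ξ, ξ⟩ = Σ_i ξ_i c(ξ_{N+1-i}) = 0` and
`h(ξ g) ≤ B` — the covering statement of the reduction theory of `U(J_N)` (Borel (1963) §5; Godement
(1962/63) §1–§3: a fundamental set is `{g : H(g) ≥ B⁻¹}` after Witt), proved by Godement's pairing
inequality for the short case and by Mahler's criterion plus the finiteness of principal Gram matrices
in a compact set for the well-rounded case. [cite: Godement1964, §1.2 and §3] -/
theorem exists_forall_exists_isotropic_vecHeight_le [NeZero N] (hN : 2 ≤ N) :
    ∃ B : ℝ≥0, ∀ g : (quasiSplit F E c N).Adelic, ∃ ξ : Fin N → E, ξ ≠ 0 ∧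
      ∑ i, ξ i * c (ξ (Fin.rev i)) = 0 ∧
      vecHeight E (principalVec E ξ ᵥ* (adelicVal F E c N _ g : Matrix (Fin N) (Fin N) (AdeleRing (𝓞 E) E))) ≤ B := by
  classical
  haveI : Nontrivial (AdeleRing (𝓞 E) E) :=
    inferInstanceAs (Nontrivial (InfiniteAdeleRing E × FiniteAdeleRing (𝓞 E) E))
  obtain ⟨C, hC, hMah⟩ := exists_isCompact_forall_exists_eq_mul (F := F) (E := E) (c := c) (N := N)
  -- the Gram map and the finite set of principal Gram matrices over `C`
  set G : GL (Fin N) (AdeleRing (𝓞 E) E) → Matrix (Fin N) (Fin N) (AdeleRing (𝓞 E) E) := fun m =>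
    (m : Matrix (Fin N) (Fin N) (AdeleRing (𝓞 E) E)) * (StdForm.antidiagonal N).over (AdeleRing (𝓞 E) E) *
      ((m : Matrix (Fin N) (Fin N) (AdeleRing (𝓞 E) E)).map (conjAdele F E c))ᵀ with hG
  have hGc : Continuous G := continuous_gram
  have hfin : (G '' C ∩ Godement.principalMatrices E).Finite :=
    Godement.finite_inter_principalMatrices E (hC.image hGc)
  -- one rational witness per Gram class
  let γw : Matrix (Fin N) (Fin N) (AdeleRing (𝓞 E) E) → GL (Fin N) E := fun Γ =>
    if h : ∃ γ : GL (Fin N) E, ∃ g' : (quasiSplit F E c N).Adelic, ∃ m' ∈ C,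
        adelicVal F E c N _ g' = Matrix.GeneralLinearGroup.map (algebraMap E (AdeleRing (𝓞 E) E)) γ * m' ∧
          G m' = Γ then h.choose else 1
  let a : Matrix (Fin N) (Fin N) (AdeleRing (𝓞 E) E) → (Fin N → E) := fun Γ =>
    (Pi.single (0 : Fin N) (1 : E) : Fin N → E) ᵥ* (γw Γ : Matrix (Fin N) (Fin N) E)
  have ha0 : ∀ Γ, a Γ ≠ 0 := by
    intro Γ h
    have h' := eq_zero_of_vecMul_eq_zero (γw Γ) h
    exact (one_ne_zero : (1 : E) ≠ 0) (by simpa using congrFun h' 0)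
  -- the height bound on `C`
  obtain ⟨BC, hBC⟩ := exists_matHeightBound_le_of_isCompact (K := E)
    (hC.image (Units.continuous_val : Continuous fun m : GL (Fin N) (AdeleRing (𝓞 E) E) =>
      (m : Matrix (Fin N) (Fin N) (AdeleRing (𝓞 E) E))))
  set B : ℝ≥0 := max 1 (BC * hfin.toFinset.sup fun Γ => vecHeight E (principalVec E (a Γ))) with hB
  refine ⟨B, fun g => ?_⟩
  set M : GL (Fin N) (AdeleRing (𝓞 E) E) := adelicVal F E c N _ g with hM
  obtain ⟨ξ₀, hξ₀, hmin⟩ := exists_vecHeight_vecMul_le_two_mul (K := E) M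
  by_cases hlt : vecHeight E (principalVec E ξ₀ ᵥ* (M : Matrix (Fin N) (Fin N) (AdeleRing (𝓞 E) E))) < 1
  · -- Case A: the almost-shortest vector is short, hence isotropic
    exact ⟨ξ₀, hξ₀, isotropic_of_vecHeight_vecMul_lt_one g hlt, hlt.le.trans (le_max_left _ _)⟩
  · -- Case B: all rational vectors are long; Mahler
    rw [not_lt] at hlt
    have hhalf : ∀ ξ : Fin N → E, ξ ≠ 0 →
        (2 : ℝ≥0)⁻¹ ≤ vecHeight E (principalVec E ξ ᵥ* (M : Matrix (Fin N) (Fin N) (AdeleRing (𝓞 E) E))) := by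
      intro ξ hξ
      have h2 : (1 : ℝ≥0) ≤ 2 * vecHeight E (principalVec E ξ ᵥ* (M : Matrix (Fin N) (Fin N) (AdeleRing (𝓞 E) E))) :=
        hlt.trans (hmin ξ hξ)
      calc (2 : ℝ≥0)⁻¹ = 2⁻¹ * 1 := (mul_one _).symm
        _ ≤ 2⁻¹ * (2 * vecHeight E (principalVec E ξ ᵥ* (M : Matrix (Fin N) (Fin N) (AdeleRing (𝓞 E) E)))) :=
            mul_le_mul_of_nonneg_left h2 (by positivity)
        _ = vecHeight E (principalVec E ξ ᵥ* (M : Matrix (Fin N) (Fin N) (AdeleRing (𝓞 E) E))) := by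
            rw [← mul_assoc, inv_mul_cancel₀ two_ne_zero, one_mul]
    obtain ⟨γ₀, m₀, hm₀, hγm⟩ := hMah g hhalf
    have hm₀GL : (Matrix.GeneralLinearGroup.map (algebraMap E (AdeleRing (𝓞 E) E)) γ₀)⁻¹ * M = m₀ :=
      inv_mul_eq_of_eq_mul hγm
    have hm₀eq : (m₀ : Matrix (Fin N) (Fin N) (AdeleRing (𝓞 E) E)) =
        ((γ₀⁻¹ : GL (Fin N) E) : Matrix (Fin N) (Fin N) E).map (algebraMap E (AdeleRing (𝓞 E) E)) *
          (M : Matrix (Fin N) (Fin N) (AdeleRing (𝓞 E) E)) := by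
      rw [← hm₀GL, ← map_inv, Units.val_mul]
      rfl
    -- the Gram class of `m₀` is principal and in `G '' C`
    have hΓP : G m₀ ∈ Godement.principalMatrices E := by
      show (m₀ : Matrix (Fin N) (Fin N) (AdeleRing (𝓞 E) E)) * (StdForm.antidiagonal N).over (AdeleRing (𝓞 E) E) *
        ((m₀ : Matrix (Fin N) (Fin N) (AdeleRing (𝓞 E) E)).map (conjAdele F E c))ᵀ ∈ _
      rw [hm₀eq, gram_mul_adelicVal]
      exact gram_map_algebraMap_mem_principalMatrices _
    have hΓ : G m₀ ∈ hfin.toFinset := hfin.mem_toFinset.2 ⟨⟨m₀, hm₀, rfl⟩, hΓP⟩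
    -- the chosen witness of this Gram class
    have hW : ∃ γ : GL (Fin N) E, ∃ g' : (quasiSplit F E c N).Adelic, ∃ m' ∈ C,
        adelicVal F E c N _ g' = Matrix.GeneralLinearGroup.map (algebraMap E (AdeleRing (𝓞 E) E)) γ * m' ∧
          G m' = G m₀ :=
      ⟨γ₀, g, m₀, hm₀, hγm, rfl⟩
    have hγw : γw (G m₀) = hW.choose := dif_pos hW
    obtain ⟨g', m', hm', hg'eq, hGm'⟩ := hW.choose_spec
    -- the candidate `ξ = (e₀ γ_Γ) γ₀⁻¹`
    refine ⟨a (G m₀) ᵥ* ((γ₀⁻¹ : GL (Fin N) E) : Matrix (Fin N) (Fin N) E), ?_, ?_, ?_⟩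
    · intro h
      exact ha0 _ (eq_zero_of_vecMul_eq_zero γ₀⁻¹ h)
    · -- isotropy, read in `𝔸_E`
      apply (algebraMap E (AdeleRing (𝓞 E) E)).injective
      rw [map_zero, ← dotProduct_antidiag_conj_principalVec_vecMul g]
      -- `ξ g = (a)_𝔸 m₀`
      have hξM : principalVec E (a (G m₀) ᵥ* ((γ₀⁻¹ : GL (Fin N) E) : Matrix (Fin N) (Fin N) E)) ᵥ*
          (adelicVal F E c N _ g : Matrix (Fin N) (Fin N) (AdeleRing (𝓞 E) E)) =
          principalVec E (a (G m₀)) ᵥ* (m₀ : Matrix (Fin N) (Fin N) (AdeleRing (𝓞 E) E)) := by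
        rw [← principalVec_vecMul_map_algebraMap, Matrix.vecMul_vecMul, ← hM, ← hm₀eq]
      have hGG : (m₀ : Matrix (Fin N) (Fin N) (AdeleRing (𝓞 E) E)) *
          (StdForm.antidiagonal N).over (AdeleRing (𝓞 E) E) *
          ((m₀ : Matrix (Fin N) (Fin N) (AdeleRing (𝓞 E) E)).map (conjAdele F E c))ᵀ =
          (m' : Matrix (Fin N) (Fin N) (AdeleRing (𝓞 E) E)) *
          (StdForm.antidiagonal N).over (AdeleRing (𝓞 E) E) *
          ((m' : Matrix (Fin N) (Fin N) (AdeleRing (𝓞 E) E)).map (conjAdele F E c))ᵀ := hGm'.symm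
      rw [hξM, pairing_vecMul_eq, hGG, ← pairing_vecMul_eq]
      -- `(a)_𝔸 m' = e₀ γ_Γ m' = e₀ g'`
      have haM' : principalVec E (a (G m₀)) ᵥ* (m' : Matrix (Fin N) (Fin N) (AdeleRing (𝓞 E) E)) =
          Pi.single (0 : Fin N) 1 ᵥ* (adelicVal F E c N _ g' : Matrix (Fin N) (Fin N) (AdeleRing (𝓞 E) E)) := by
        rw [hg'eq, Units.val_mul, ← Matrix.vecMul_vecMul, ← hγw]
        congr 1
        rw [← single_vecMul_map_algebraMap]
        rfl
      rw [haM', dotProduct_antidiag_conj_vecMul_eq]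
      exact dotProduct_antidiag_conj_single_zero hN
    · -- the height bound
      have hξM : principalVec E (a (G m₀) ᵥ* ((γ₀⁻¹ : GL (Fin N) E) : Matrix (Fin N) (Fin N) E)) ᵥ*
          (adelicVal F E c N _ g : Matrix (Fin N) (Fin N) (AdeleRing (𝓞 E) E)) =
          principalVec E (a (G m₀)) ᵥ* (m₀ : Matrix (Fin N) (Fin N) (AdeleRing (𝓞 E) E)) := by
        rw [← principalVec_vecMul_map_algebraMap, Matrix.vecMul_vecMul, ← hM, ← hm₀eq]
      rw [hξM]
      have hfa : IsHeightFinite E (principalVec E (a (G m₀))) := isHeightFinite_principalVec (ha0 _)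
      have hfaM : IsHeightFinite E (principalVec E (a (G m₀)) ᵥ* (m₀ : Matrix (Fin N) (Fin N) (AdeleRing (𝓞 E) E))) :=
        isHeightFinite_principalVec_vecMul (ha0 _) m₀
      calc vecHeight E (principalVec E (a (G m₀)) ᵥ* (m₀ : Matrix (Fin N) (Fin N) (AdeleRing (𝓞 E) E)))
          ≤ matHeightBound E (m₀ : Matrix (Fin N) (Fin N) (AdeleRing (𝓞 E) E)) * vecHeight E (principalVec E (a (G m₀))) :=
            vecHeight_vecMul_le hfa hfaM
        _ ≤ BC * hfin.toFinset.sup (fun Γ => vecHeight E (principalVec E (a Γ))) :=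
            mul_le_mul' (hBC _ ⟨m₀, hm₀, rfl⟩)
              (Finset.le_sup (f := fun Γ => vecHeight E (principalVec E (a Γ))) hΓ)
        _ ≤ B := le_max_right _ _

end UnitaryGroup

end Literature.NumberTheory.Automorphic
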